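import Summits.HodgeConjecture.CorCM.IrreducibleOddWeightsHodgeGluing
import HarnessLib

/-!
# HODGE GLUING ALONG BLOCKS: if `Hg(∏_i A_i) = ∏_c Hg(∏_{κ i = c} A_i)` for a partition `κ` of the factors, the Hodge
# conjecture for the products of copies INSIDE each block implies it for EVERY product of copies `∏_j A_{π j}`

COR-CM (cell `pub-hodgecm2`, binder seat `b16` gen 60, count-neutral claim HODGE GLUING, file G5 — abstract `G`-slots, CM
fields and their realisations; theorems only, no definition, no named fact, no `sorry`).  NEW as stated, hence under
`Summits/`.  HONEST FRAMING: an unconditional reduction between instances of the Hodge conjecture for CM abelian varieties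
(the Hodge conjecture inside the blocks is a HYPOTHESIS); `HC_CM` is neither used nor asserted.

File G3 (`hodgeConjectureFor_biproduct_of_cmFamilyRank_add_card_eq`) glues along a family whose MEMBERS are additive
(`Hg(∏_i A_i) = ∏_i Hg(A_i)`).  Here the members are replaced by the BLOCKS of a partition `κ : I ↠ C`: the hypothesis is
block additivity `cmFamilyRank Φ + |C| = Σ_c cmFamilyRank Φ|_{κ = c} + 1` (`Hg(∏_i A_i) = ∏_c Hg(∏_{κ i = c} A_i)`; inside a
block nothing is assumed — a block may be `E × E'` with `E ∼ E'`, a Weil-type pair, …), and the Hodge conjecture is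
assumed for every product of copies of members of ONE block.

* §1 (abstract) `IrrOdd.typeRank_sum_subtype_eq` (the glued two-block type along a predicate has the rank of `Σ`),
  `IrrOdd.typeRank_sigmaType_fiber_ne_eq` (blocks of the rest family), **`IrrOdd.typeRank_sum_add_one_eq_of_fiber_add_card_eq`**:
  block additivity ⟹ two-block additivity of (`κ = c₀` | `κ ≠ c₀`), i.e. `Hg(X_{c₀} × Y) = Hg(X_{c₀}) × Hg(Y)` for
  `Y = ∏_{κ i ≠ c₀} A_i` (sandwich: `rank(Σ) + 1 ≤ rank Σ_{c₀} + rank Σ_{≠c₀}` and block subadditivity of the rest).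
* §2 CM dress `typeRank_sum_add_one_eq_cmFamilyRank_of_fiber_add_card_eq`.
* §3 **`hodgeConjectureFor_biproduct_of_cmFamilyRank_fiber_add_card_eq`** — THE BLOCK GLUING THEOREM (induction on the
  number of blocks met by `π`, splitting off one block; G2's product span for the two slot families).
* §4 **`hodgeConjectureFor_biproduct_of_conj_apply_eq_fiber`** — field form: the composita `L_c = ∏_{κ i = c} K_i^{gal}`
  of the blocks PAIRWISE meet in totally real fields (complex conjugation fixes `L_c ∩ L_{c'}` pointwise, `c ≠ c'`) ⟹
  gluing (block additivity by `Pohlmann1968.CMAlgebra.cmFamilyRank_add_card_eq_of_conj_apply_eq_fiber`, seat p2) — the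
  `n`-block, arbitrary-type form of `TotallyRealIntersectionCMProductsHodge` (two blocks) and of
  `CMFamilyRankPartition.hodgeConjectureFor_prod_of_forall_fiber` (nondegenerate blocks); `…_of_partialConj_fiber` likewise.

## References

* [MoonenZarhin1999LowDim] B. Moonen, Yu. Zarhin, *Hodge classes on abelian varieties of low dimension*, Math. Ann.
  315 (1999), §3 (3.1).
* [Gordon1999HodgeAVSurvey] B. B. Gordon, *A survey of the Hodge conjecture for abelian varieties*, §3 Theorem (Imai,
  Murty) with proof; 7.5–7.7.
* [vanGeemen1994HodgeAV] B. van Geemen, *An introduction to the Hodge conjecture for abelian varieties*, LNM 1594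
  (1994), §3.5–3.7 Lemma 3.7.
* [Lang2002] S. Lang, *Algebra*, GTM 211, VI §1 Thm. 1.14.
-/

set_option autoImplicit false

noncomputable section

open scoped BigOperators

open CategoryTheory CategoryTheory.Limits NumberField IntermediateField

namespace Summit.HodgeConjecture.CorCM

namespace IrrOdd

open Literature.NumberTheory.ComplexMultiplication

universe w u v

variable {G : Type w} [Group G] {I : Type u} {E : I → Type v} [∀ i, MulAction G (E i)] [Fintype I]
  [∀ i, Fintype (E i)] [∀ i, Nonempty (E i)]

/-! ### §1 Abstract slots: block additivity gives two-block additivity against one block -/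

omit [Fintype I] [∀ i, Fintype (E i)] [∀ i, Nonempty (E i)] in
/-- The glued two-block type of `(Φ_i)_{p i}` and `(Φ_i)_{¬p i}` on the disjoint union of their slots has the Kubota rank
of the family type `Σ` (it IS `Σ`, read through the equivariant bijection onto `⊔_i E_i`). [cite: Deligne1982HodgeCycles, I Ex. 3.7] -/
theorem typeRank_sum_subtype_eq (Φ : ∀ i, Set (E i)) (p : I → Prop) [DecidablePred p] :
    typeRank G {z : (Σ i : {i // p i}, E i.1) ⊕ (Σ i : {i // ¬p i}, E i.1) |
        Sum.elim (· ∈ sigmaType fun i : {i // p i} => Φ i.1) (· ∈ sigmaType fun i : {i // ¬p i} => Φ i.1) z} =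
      typeRank G (sigmaType Φ) := by
  set q : (Σ i : {i // p i}, E i.1) ⊕ (Σ i : {i // ¬p i}, E i.1) → Σ i, E i :=
    Sum.elim (fun x => ⟨x.1.1, x.2⟩) (fun x => ⟨x.1.1, x.2⟩) with hq
  have hq_smul : ∀ (g : G) (z : (Σ i : {i // p i}, E i.1) ⊕ (Σ i : {i // ¬p i}, E i.1)), q (g • z) = g • q z := by
    intro g z
    rcases z with ⟨⟨i, hi⟩, s⟩ | ⟨⟨i, hi⟩, s⟩ <;> rfl
  have hq_surj : Function.Surjective q := by
    rintro ⟨i, s⟩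
    by_cases hi : p i
    · exact ⟨Sum.inl ⟨⟨i, hi⟩, s⟩, rfl⟩
    · exact ⟨Sum.inr ⟨⟨i, hi⟩, s⟩, rfl⟩
  have hq_pre : q ⁻¹' sigmaType Φ = {z | Sum.elim (· ∈ sigmaType fun i : {i // p i} => Φ i.1)
      (· ∈ sigmaType fun i : {i // ¬p i} => Φ i.1) z} := by
    ext z
    rcases z with ⟨⟨i, hi⟩, s⟩ | ⟨⟨i, hi⟩, s⟩ <;> rfl
  rw [← hq_pre]
  exact typeRank_preimage_eq_of_surjective (G := G) (sigmaType Φ) q hq_smul hq_surj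

omit [Fintype I] [∀ i, Fintype (E i)] [∀ i, Nonempty (E i)] in
/-- The blocks of the rest family `(Φ_i)_{κ i ≠ c₀}` (partitioned by `κ` into the classes `c ≠ c₀`) have the ranks of
the blocks of `Φ`. [cite: Deligne1982HodgeCycles, I Ex. 3.7] -/
theorem typeRank_sigmaType_fiber_ne_eq {C : Type*} (Φ : ∀ i, Set (E i)) (κ : I → C) (c₀ : C) (c : {c // c ≠ c₀}) :
    typeRank G (sigmaType fun i : {i : {i // ¬κ i = c₀} // (⟨κ i.1, i.2⟩ : {c // c ≠ c₀}) = c} => Φ i.1.1) =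
      typeRank G (sigmaType fun i : {i // κ i = c.1} => Φ i.1) := by
  set q : (Σ i : {i : {i // ¬κ i = c₀} // (⟨κ i.1, i.2⟩ : {c // c ≠ c₀}) = c}, E i.1.1) →
      Σ i : {i // κ i = c.1}, E i.1 := fun x => ⟨⟨x.1.1.1, congrArg Subtype.val x.1.2⟩, x.2⟩ with hq
  have hq_smul : ∀ (g : G) (x : Σ i : {i : {i // ¬κ i = c₀} // (⟨κ i.1, i.2⟩ : {c // c ≠ c₀}) = c}, E i.1.1),
      q (g • x) = g • q x := fun g x => rfl
  have hq_surj : Function.Surjective q := by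
    rintro ⟨⟨i, hi⟩, s⟩
    have hi₀ : ¬κ i = c₀ := fun h => c.2 (hi.symm.trans h)
    exact ⟨⟨⟨⟨i, hi₀⟩, Subtype.ext hi⟩, s⟩, rfl⟩
  have hq_pre : q ⁻¹' (sigmaType fun i : {i // κ i = c.1} => Φ i.1) =
      sigmaType fun i : {i : {i // ¬κ i = c₀} // (⟨κ i.1, i.2⟩ : {c // c ≠ c₀}) = c} => Φ i.1.1 := rfl
  rw [← hq_pre]
  exact typeRank_preimage_eq_of_surjective (G := G) _ q hq_smul hq_surj

/-- **BLOCK ADDITIVITY GIVES TWO-BLOCK ADDITIVITY AGAINST ANY ONE BLOCK.**  `G` permutes finite slots `E_i`, `Φ_i` are CM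
types for `ρ`, `κ : I ↠ C` a partition with `rank(Σ) + |C| = Σ_c rank(Σ|_c) + 1` (`Hg(∏_i A_i) = ∏_c Hg(∏_{κ i = c} A_i)`),
and `c₀` a block with non-empty complement.  THEN `rank(Σ|_{c₀} ⊔ Σ|_{≠c₀}) + 1 = rank(Σ|_{c₀}) + rank(Σ|_{≠c₀})`:
`Hg(X_{c₀} × Y) = Hg(X_{c₀}) × Hg(Y)` for `Y = ∏_{κ i ≠ c₀} A_i`.  (Sandwich: `rank(Σ) + 1 ≤ rank Σ|_{c₀} + rank Σ|_{≠c₀}`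
and `rank(Σ|_{≠c₀}) + (|C| − 1) ≤ Σ_{c ≠ c₀} rank(Σ|_c) + 1`; the total is the hypothesis, so neither is strict.)
[cite: MoonenZarhin1999LowDim, §3 (3.1)] [cite: Gordon1999HodgeAVSurvey, 7.7] -/
theorem typeRank_sum_add_one_eq_of_fiber_add_card_eq {C : Type*} [Fintype C] [DecidableEq C] {ρ : G}
    {Φ : ∀ i, Set (E i)} (h : ∀ i, IsCMTypeWith ρ (Φ i)) (κ : I → C) (hκ : Function.Surjective κ)
    (hadd : typeRank G (sigmaType Φ) + Fintype.card C =
      (∑ c, typeRank G (sigmaType fun i : {i // κ i = c} => Φ i.1)) + 1)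
    (c₀ : C) (hne : ∃ i, ¬κ i = c₀) :
    typeRank G {z : (Σ i : {i // κ i = c₀}, E i.1) ⊕ (Σ i : {i // ¬κ i = c₀}, E i.1) |
        Sum.elim (· ∈ sigmaType fun i : {i // κ i = c₀} => Φ i.1) (· ∈ sigmaType fun i : {i // ¬κ i = c₀} => Φ i.1) z}
        + 1 =
      typeRank G (sigmaType fun i : {i // κ i = c₀} => Φ i.1) +
        typeRank G (sigmaType fun i : {i // ¬κ i = c₀} => Φ i.1) := by
  obtain ⟨i₁, hi₁⟩ := hκ c₀
  obtain ⟨i₂, hi₂⟩ := hne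
  haveI : Nonempty {i // κ i = c₀} := ⟨⟨i₁, hi₁⟩⟩
  haveI : Nonempty {i // ¬κ i = c₀} := ⟨⟨i₂, hi₂⟩⟩
  haveI : Nonempty (Σ i : {i // κ i = c₀}, E i.1) := ⟨⟨⟨i₁, hi₁⟩, Classical.arbitrary (E i₁)⟩⟩
  haveI : Nonempty (Σ i : {i // ¬κ i = c₀}, E i.1) := ⟨⟨⟨i₂, hi₂⟩, Classical.arbitrary (E i₂)⟩⟩
  have hP : IsCMTypeWith ρ (sigmaType fun i : {i // κ i = c₀} => Φ i.1) := IsCMTypeWith.sigmaType fun i => h i.1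
  have hN : IsCMTypeWith ρ (sigmaType fun i : {i // ¬κ i = c₀} => Φ i.1) := IsCMTypeWith.sigmaType fun i => h i.1
  -- two-block subadditivity, the glued type being `Σ`
  have hle := typeRank_sum_add_one_le hP hN
  have hglue := typeRank_sum_subtype_eq (G := G) Φ (fun i => κ i = c₀)
  -- block subadditivity of the rest family, partitioned by `κ` into the classes `c ≠ c₀`
  set κ' : {i // ¬κ i = c₀} → {c // c ≠ c₀} := fun i => ⟨κ i.1, i.2⟩ with hκ'
  have hκ'surj : Function.Surjective κ' := by
    rintro ⟨c, hc⟩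
    obtain ⟨i, rfl⟩ := hκ c
    exact ⟨⟨i, hc⟩, rfl⟩
  have hrest := typeRank_sigmaType_add_card_le_fiber (E := fun i : {i // ¬κ i = c₀} => E i.1) (fun i => h i.1) κ'
    hκ'surj
  have hfib : ∀ c : {c // c ≠ c₀},
      typeRank G (sigmaType fun i : {i : {i // ¬κ i = c₀} // κ' i = c} => Φ i.1.1) =
        typeRank G (sigmaType fun i : {i // κ i = c.1} => Φ i.1) := fun c =>
    typeRank_sigmaType_fiber_ne_eq (G := G) Φ κ c₀ c
  rw [Finset.sum_congr rfl fun c _ => hfib c] at hrest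
  -- splitting `Σ_c rank(Σ|_c)` and `|C|` at `c₀` (Finset algebra on `univ : Finset C`)
  have hmem : ∀ x : C, x ∈ Finset.univ.erase c₀ ↔ ¬x = c₀ := fun x => by
    rw [Finset.mem_erase]
    exact ⟨fun hx => hx.1, fun hx => ⟨hx, Finset.mem_univ x⟩⟩
  have hsum' : ∑ c : {c // ¬c = c₀}, typeRank G (sigmaType fun i : {i // κ i = c.1} => Φ i.1) =
      ∑ c ∈ Finset.univ.erase c₀, typeRank G (sigmaType fun i : {i // κ i = c} => Φ i.1) :=
    (Finset.sum_subtype (Finset.univ.erase c₀) hmem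
      fun c => typeRank G (sigmaType fun i : {i // κ i = c} => Φ i.1)).symm
  have hsum : typeRank G (sigmaType fun i : {i // κ i = c₀} => Φ i.1) +
      ∑ c ∈ Finset.univ.erase c₀, typeRank G (sigmaType fun i : {i // κ i = c} => Φ i.1) =
        ∑ c, typeRank G (sigmaType fun i : {i // κ i = c} => Φ i.1) :=
    Finset.add_sum_erase Finset.univ (fun c => typeRank G (sigmaType fun i : {i // κ i = c} => Φ i.1))
      (Finset.mem_univ c₀)
  have hcard' : Fintype.card {c // ¬c = c₀} = (Finset.univ.erase c₀).card := Fintype.card_of_subtype _ hmem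
  have hcard : (Finset.univ.erase c₀).card + 1 = Fintype.card C := by
    rw [Finset.card_erase_of_mem (Finset.mem_univ c₀), Finset.card_univ]
    haveI : Nonempty C := ⟨c₀⟩
    have := Fintype.card_pos (α := C)
    omega
  rw [hglue] at hle ⊢
  rw [hsum', hcard'] at hrest
  omega

end IrrOdd

/-! ### §2 CM fields -/

open Literature.NumberTheory.ComplexMultiplication
open Literature.AlgebraicGeometry.Motives (AbelianVariety CMType)
open Literature.AlgebraicGeometry.Motives.AbelianVariety
open Literature.AlgebraicGeometry.HodgeTheory
open Literature.AlgebraicGeometry.ComplexMultiplication (IsCMTypeRealisation)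
open Literature.AlgebraicGeometry.Pohlmann1968

variable {I : Type} [Fintype I] {K : I → Type} [∀ i, Field (K i)] [∀ i, NumberField (K i)] [∀ i, IsCMField (K i)]
  {C : Type} [Fintype C] [DecidableEq C]

/-- **Block additivity ⟹ `Hg(X_{c₀} × Y) = Hg(X_{c₀}) × Hg(Y)`** for CM fields: `κ : I ↠ C`,
`cmFamilyRank Φ + |C| = Σ_c cmFamilyRank Φ|_{κ = c} + 1` (`Hg(∏_i A_i) = ∏_c Hg(∏_{κ i = c} A_i)`), `c₀` with non-empty
complement ⟹ the glued type of `Φ|_{κ = c₀}` and `Φ|_{κ ≠ c₀}` satisfies the two-block rank identity (the hypothesis of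
`Pohlmann1968.hodgeClassesProductSpan_biproduct_of_typeRank_add`). [cite: MoonenZarhin1999LowDim, §3 (3.1)] [cite: Gordon1999HodgeAVSurvey, 7.7] -/
theorem typeRank_sum_add_one_eq_cmFamilyRank_of_fiber_add_card_eq (Φ : ∀ i, CMType (K i)) (κ : I → C)
    (hκ : Function.Surjective κ)
    (hadd : CMAlgebra.cmFamilyRank Φ + Fintype.card C =
      (∑ c, CMAlgebra.cmFamilyRank fun i : {i // κ i = c} => Φ i.1) + 1)
    (c₀ : C) (hne : ∃ i, ¬κ i = c₀) :
    typeRank (ℂ ≃+* ℂ) {z : (Σ i : {i // κ i = c₀}, (K i.1 →+* ℂ)) ⊕ (Σ i : {i // ¬κ i = c₀}, (K i.1 →+* ℂ)) |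
        Sum.elim (· ∈ CMAlgebra.familyType fun i : {i // κ i = c₀} => Φ i.1)
          (· ∈ CMAlgebra.familyType fun i : {i // ¬κ i = c₀} => Φ i.1) z} + 1 =
      CMAlgebra.cmFamilyRank (fun i : {i // κ i = c₀} => Φ i.1) +
        CMAlgebra.cmFamilyRank (fun i : {i // ¬κ i = c₀} => Φ i.1) :=
  IrrOdd.typeRank_sum_add_one_eq_of_fiber_add_card_eq (G := ℂ ≃+* ℂ) (E := fun i => K i →+* ℂ)
    (Φ := fun i => (Φ i).1) (fun i => isCMTypeWith_conj (Φ i)) κ hκ hadd c₀ hne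

/-! ### §3 The block gluing theorem -/

variable {Φ : ∀ i, CMType (K i)} {A : I → AbelianVariety ℂ} {ιA : ∀ i, 𝓞 (K i) →+* End (A i)}
  {θ : ∀ i, K i →+* Module.End ℂ (complexBetti (A i).X 1)}

/-- **HODGE GLUING ALONG THE BLOCKS OF A PARTITION.**  `A_i ⊨ (K_i; Φ_i)` (`i ∈ I` finite) realisations of CM types,
`κ : I ↠ C` a partition of the factors with BLOCK ADDITIVITY `cmFamilyRank Φ + |C| = Σ_c cmFamilyRank Φ|_{κ = c} + 1`,
i.e. `Hg(∏_i A_i) = ∏_c Hg(∏_{κ i = c} A_i)` — nothing is assumed inside a block.  IF the Hodge conjecture holds for every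
product of copies of members of each single block (`⨁_j A_{π j}` with all `κ (π j) = c`), THEN it holds for every
product of copies `⨁_{j ∈ J} A_{π j}` whatsoever.  Induction on the number of blocks met by `π`; one block is split off
with `hodgeClassesProductSpan_biproduct_comp_of_typeRank_add` under the two-block identity of §2.
[cite: MoonenZarhin1999LowDim, §3 (3.1)] [cite: Gordon1999HodgeAVSurvey, §3 Theorem (Imai, Murty) with proof, 7.5–7.7]
[cite: vanGeemen1994HodgeAV, §3.5–3.7 Lemma 3.7 (p. 236)] -/
theorem hodgeConjectureFor_biproduct_of_cmFamilyRank_fiber_add_card_eq (κ : I → C) (hκ : Function.Surjective κ)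
    (hadd : CMAlgebra.cmFamilyRank Φ + Fintype.card C =
      (∑ c, CMAlgebra.cmFamilyRank fun i : {i // κ i = c} => Φ i.1) + 1)
    (hA : ∀ i, IsCMTypeRealisation (Φ i) (A i) (ιA i) (θ i))
    (hHC : ∀ (c : C) (J : Type) [Fintype J] [Nonempty J] (π : J → {i // κ i = c}),
      HodgeConjectureFor (⨁ fun j => A (π j).1).dim (⨁ fun j => A (π j).1).X)
    {J : Type} [Fintype J] [Nonempty J] (π : J → I) :
    HodgeConjectureFor (⨁ fun j => A (π j)).dim (⨁ fun j => A (π j)).X := by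
  classical
  -- induction on the number of blocks met by `π`
  suffices key : ∀ (n : ℕ) {J : Type} [Fintype J] [Nonempty J] (π : J → I),
      (Finset.univ.image fun j => κ (π j)).card ≤ n →
        HodgeConjectureFor (⨁ fun j => A (π j)).dim (⨁ fun j => A (π j)).X from
    key _ π le_rfl
  intro n
  induction n with
  | zero =>
    intro J _ _ π hcard
    obtain ⟨j₀⟩ := ‹Nonempty J›
    exact absurd (Finset.card_pos.2 ⟨κ (π j₀), Finset.mem_image_of_mem (fun j => κ (π j)) (Finset.mem_univ j₀)⟩)
      (by omega)
  | succ n ih =>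
    intro J _ _ π hcard
    obtain ⟨j₀⟩ := ‹Nonempty J›
    by_cases hall : ∀ j, κ (π j) = κ (π j₀)
    · -- one block only
      exact hHC (κ (π j₀)) J fun j => ⟨π j, hall j⟩
    · push Not at hall
      obtain ⟨j₁, hj₁⟩ := hall
      let p : J → Prop := fun j => κ (π j) = κ (π j₀)
      haveI : Nonempty {j // p j} := ⟨⟨j₀, rfl⟩⟩
      haveI : Nonempty {j // ¬p j} := ⟨⟨j₁, hj₁⟩⟩
      -- the part inside the block of `π j₀`
      have hX : HodgeConjectureFor (⨁ fun j : {j // p j} => A (π j.1)).dim (⨁ fun j : {j // p j} => A (π j.1)).X :=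
        hHC (κ (π j₀)) {j // p j} fun j => ⟨π j.1, j.2⟩
      -- the other blocks: fewer of them
      have hY : HodgeConjectureFor (⨁ fun j : {j // ¬p j} => A (π j.1)).dim
          (⨁ fun j : {j // ¬p j} => A (π j.1)).X := by
        refine ih (fun j : {j // ¬p j} => π j.1) ?_
        have hsub : (Finset.univ.image fun j : {j // ¬p j} => κ (π j.1)) ⊆
            (Finset.univ.image fun j => κ (π j)).erase (κ (π j₀)) := by
          intro c hc
          obtain ⟨j, -, rfl⟩ := Finset.mem_image.1 hc
          exact Finset.mem_erase.2 ⟨j.2, Finset.mem_image_of_mem (fun j => κ (π j)) (Finset.mem_univ j.1)⟩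
        have h0 : κ (π j₀) ∈ Finset.univ.image fun j => κ (π j) :=
          Finset.mem_image_of_mem (fun j => κ (π j)) (Finset.mem_univ j₀)
        have h1 := Finset.card_le_card hsub
        rw [Finset.card_erase_of_mem h0] at h1
        omega
      -- glue along `κ = κ (π j₀)` versus the rest
      have hrank := typeRank_sum_add_one_eq_cmFamilyRank_of_fiber_add_card_eq Φ κ hκ hadd (κ (π j₀))
        ⟨π j₁, hj₁⟩
      haveI : Nonempty {i // κ i = κ (π j₀)} := ⟨⟨π j₀, rfl⟩⟩
      haveI : Nonempty {i // ¬κ i = κ (π j₀)} := ⟨⟨π j₁, hj₁⟩⟩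
      have hspan := hodgeClassesProductSpan_biproduct_comp_of_typeRank_add
        (K₁ := fun i : {i // κ i = κ (π j₀)} => K i.1) (K₂ := fun i : {i // ¬κ i = κ (π j₀)} => K i.1)
        (Φ₁ := fun i : {i // κ i = κ (π j₀)} => Φ i.1) (Φ₂ := fun i : {i // ¬κ i = κ (π j₀)} => Φ i.1)
        (A₁ := fun i : {i // κ i = κ (π j₀)} => A i.1) (A₂ := fun i : {i // ¬κ i = κ (π j₀)} => A i.1)
        (fun i => hA i.1) (fun i => hA i.1) hrank (fun j : {j // p j} => (⟨π j.1, j.2⟩ : {i // κ i = κ (π j₀)}))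
        (fun j : {j // ¬p j} => (⟨π j.1, j.2⟩ : {i // ¬κ i = κ (π j₀)}))
      have hprod := hodgeConjectureFor_prod_of_productSpan _ _ hspan hX hY
      exact HodgeConjectureFor.of_isIsogenous (isIsogenous_biproduct_prod_subtype (fun j => A (π j)) p) hprod

/-- **Isogenous carriers** of the block gluing theorem. [cite: vanGeemen1994HodgeAV, §3.5–3.7 Lemma 3.7 (p. 236)] -/
theorem hodgeConjectureFor_of_isIsogenous_biproduct_of_cmFamilyRank_fiber_add_card_eq (κ : I → C)
    (hκ : Function.Surjective κ)
    (hadd : CMAlgebra.cmFamilyRank Φ + Fintype.card C =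
      (∑ c, CMAlgebra.cmFamilyRank fun i : {i // κ i = c} => Φ i.1) + 1)
    (hA : ∀ i, IsCMTypeRealisation (Φ i) (A i) (ιA i) (θ i))
    (hHC : ∀ (c : C) (J : Type) [Fintype J] [Nonempty J] (π : J → {i // κ i = c}),
      HodgeConjectureFor (⨁ fun j => A (π j).1).dim (⨁ fun j => A (π j).1).X)
    {J : Type} [Fintype J] [Nonempty J] (π : J → I) {X : AbelianVariety ℂ}
    (hX : IsIsogenous X (⨁ fun j => A (π j))) : HodgeConjectureFor X.dim X.X :=
  HodgeConjectureFor.of_isIsogenous hX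
    (hodgeConjectureFor_biproduct_of_cmFamilyRank_fiber_add_card_eq κ hκ hadd hA hHC π)

/-! ### §4 Field forms: block composita pairwise meeting in totally real fields -/

/-- **HODGE GLUING ACROSS BLOCKS WHOSE COMPOSITA OF GALOIS CLOSURES PAIRWISE MEET IN TOTALLY REAL FIELDS.**  A partition
`κ : I ↠ C` of CM fields `K_i` such that for all blocks `c ≠ c'` complex conjugation fixes
`(∏_{κ i = c} K_i^{gal}) ∩ (∏_{κ i = c'} K_i^{gal})` pointwise; ARBITRARY CM types and realisations.  If the Hodge
conjecture holds for every product of copies of members of each block, it holds for every product of copies of all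
members — any number of blocks, degenerate members allowed (two blocks: `TotallyRealIntersectionCMProductsHodge`;
nondegenerate blocks: `CMFamilyRankPartition.hodgeConjectureFor_prod_of_forall_fiber`).
[cite: MoonenZarhin1999LowDim, §3 (3.1)] [cite: Lang2002, VI §1 Thm. 1.14] [cite: Gordon1999HodgeAVSurvey, §3 Theorem (Imai, Murty) with proof] -/
theorem hodgeConjectureFor_biproduct_of_conj_apply_eq_fiber (κ : I → C) (hκ : Function.Surjective κ)
    (hreal : ∀ c c', c ≠ c' → ∀ x : ℂ, x ∈ (⨆ i : {i : I // κ i = c}, normalClosure ℚ (K i.1) ℂ) →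
      x ∈ (⨆ i : {i : I // κ i = c'}, normalClosure ℚ (K i.1) ℂ) → starRingEnd ℂ x = x)
    (hA : ∀ i, IsCMTypeRealisation (Φ i) (A i) (ιA i) (θ i))
    (hHC : ∀ (c : C) (J : Type) [Fintype J] [Nonempty J] (π : J → {i // κ i = c}),
      HodgeConjectureFor (⨁ fun j => A (π j).1).dim (⨁ fun j => A (π j).1).X)
    {J : Type} [Fintype J] [Nonempty J] (π : J → I) :
    HodgeConjectureFor (⨁ fun j => A (π j)).dim (⨁ fun j => A (π j)).X := by
  obtain ⟨j₀⟩ := ‹Nonempty J›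
  haveI : Nonempty I := ⟨π j₀⟩
  exact hodgeConjectureFor_biproduct_of_cmFamilyRank_fiber_add_card_eq κ hκ
    (CMAlgebra.cmFamilyRank_add_card_eq_of_conj_apply_eq_fiber Φ κ hκ hreal) hA hHC π

/-- **… and from partial conjugations between the blocks** (for all `c ≠ c'` some `σ ∈ Aut(ℂ)` is conjugation on the
embeddings of the fields of block `c` and the identity on those of block `c'`). [cite: Gordon1999HodgeAVSurvey, §3 Theorem (Imai, Murty) with proof]
[cite: MoonenZarhin1999LowDim, §3 (3.1)] -/
theorem hodgeConjectureFor_biproduct_of_partialConj_fiber (κ : I → C) (hκ : Function.Surjective κ)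
    (hσ : ∀ c c', c ≠ c' → ∃ σ : ℂ ≃+* ℂ, (∀ i, κ i = c → ∀ s : K i →+* ℂ, σ • s = (starRingAut : ℂ ≃+* ℂ) • s) ∧
      (∀ i, κ i = c' → ∀ s : K i →+* ℂ, σ • s = s))
    (hA : ∀ i, IsCMTypeRealisation (Φ i) (A i) (ιA i) (θ i))
    (hHC : ∀ (c : C) (J : Type) [Fintype J] [Nonempty J] (π : J → {i // κ i = c}),
      HodgeConjectureFor (⨁ fun j => A (π j).1).dim (⨁ fun j => A (π j).1).X)
    {J : Type} [Fintype J] [Nonempty J] (π : J → I) :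
    HodgeConjectureFor (⨁ fun j => A (π j)).dim (⨁ fun j => A (π j)).X := by
  obtain ⟨j₀⟩ := ‹Nonempty J›
  haveI : Nonempty I := ⟨π j₀⟩
  exact hodgeConjectureFor_biproduct_of_cmFamilyRank_fiber_add_card_eq κ hκ
    (CMAlgebra.cmFamilyRank_add_card_eq_of_partialConj_fiber Φ κ hκ hσ) hA hHC π

end Summit.HodgeConjecture.CorCM

end
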